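import Literature.NumberTheory.Weil1964.ThetaInitialTopology
import Literature.NumberTheory.Weil1964.AdelicThetaMajorants
import HarnessLib

/-!
# The theta-kernel datum of a dual pair whose Weil representation is ALREADY SPLIT

Topic `NumberTheory/Weil1964`; namespace `Literature.NumberTheory.Weil1964.ThetaKernelDatum` (continues
`ThetaKernelDualPair`, `ThetaInitialTopology`).

In [Weil1964, n° 37–41] the theta kernel of a dual pair `(G_U, U(W))` is obtained by pulling the metaplectic
theta function `Θ` on `Mp(𝕎)_A` back along a splitting `s : G_U(𝔸) × U(W)(𝔸) → Mp(𝕎)_A`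
([Kudla1994, Thm 3.1], [HarrisKudlaSweet1996, (1.14)–(1.16)]); the tree's `ThetaKernelDatum Mp SX GU ΓU G Γ`
records exactly this shape, with `Mp` a TOPOLOGICAL group (`s_cont`, Théorème 6 on `Mp`).  When the Weil
representation is delivered ALREADY LINEARISED on the pair — a homomorphism
`ω : G_U(𝔸) × U(W)(𝔸) →* End S(X_A)` (the operator model composed with the lift of a splitting function:
`Literature.GroupTheory.TwistedProduct.opHom_comp_lift_apply`, `ω = z(β ·) r(ι ·)`) — NO metaplectic group
object and NO topology on a twisted product is needed: take `Mp := G_U(𝔸) × U(W)(𝔸)` itself, `s := id`,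
`rat := ΓU × Γ` (the rational points), `Θ_Φ(g, h) := Θ(ω(g, h)Φ)`.

## What this file provides (kernel only)

* `ThetaKernelDatum.ofDualPairRep ω dist hc hinv SK SK_stable : ThetaKernelDatum (GU × G) _ GU ΓU G Γ` over
  the theta-initial topology, from: a `Representation k (GU × G) SX`; a distribution `Θ : SX → ℂ`; continuity
  of `(g, h) ↦ Θ(ω(g, h)Φ)` for each `Φ` (Théorème 6 conjunct 1 for these objects, on the LOCALLY COMPACT
  group `GU × G`); invariance `Θ(ω(γU, γ)Φ) = Θ(Φ)` for `γU ∈ ΓU`, `γ ∈ Γ` (Théorème 6 conjunct 2 +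
  rationality of the splitting, for these objects); an `ω(1 × G)`-stable index set;
* its kernel on representatives: `θ_Φ(x, h) = Θ(ω(x⁻¹, h⁻¹)Φ)` (`ofDualPairRep_thetaFun_mk`), and the
  identification of its Weil action `ω(h) = s(1, h)` with `ω(1, h)` (`ofDualPairRep_act_s_one`).

* §2, OVER THE TREE'S ADELIC CARRIER `𝒮 = piSchwartzBruhat F ι` (theta-kernel side of
  `AdelicThetaMajorants`): `ThetaKernelDatum.ofThetaMajorants ρ rat hρ hrat s …` — the datum of a homomorphism
  `ρ : Mp →* (End_ℂ 𝒮)ˣ` with theta majorants (`HasThetaMajorants`, the `M`-test form of Lemme 5) and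
  `ρ(rat) ⊆ thetaStabilizer` (the mechanism of Théorème 6 conjunct 2), pulled back along a continuous
  splitting `s : GU × G →* Mp` — and its split-pair case `ThetaKernelDatum.adelicOfDualPair ρ hρ hrat SK …`
  (`Mp := GU × G`, `s := id`); kernel `θ_Φ(x, h) = Θ(ρ(x⁻¹, h⁻¹)Φ) = Σ_{ξ ∈ F^ι} (ρ(x⁻¹, h⁻¹)Φ)(ξ)`
  (`adelicOfDualPair_thetaFun_mk`, `adelicOfDualPair_thetaFun_mk_eq_tsum`), with the variant
  `adelicOfDualPairRep` taking a Mathlib `Representation ℂ (GU × G) 𝒮` (`ω.toHomUnits`).  What then remains for the model's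
  theta kernel is exactly: the homomorphism `ρ` (the linearised adelic Weil representation of the pair), its
  majorants, and the stabiliser condition on rational points.

Every kernel law of `ThetaKernelDualPair` / `ThetaLift` / `ThetaWeightForms` then applies verbatim.

## References

* [Weil1964] A. Weil, Acta Math. 111 (1964), n° 41 Théorème 6 p. 193.
* [Kudla1994] S. Kudla, Israel J. Math. 87 (1994), Thm 3.1; [HarrisKudlaSweet1996] JAMS 9 (1996) (1.14)–(1.16).
-/

open _root_.Topology

namespace Literature.NumberTheory.Weil1964

namespace ThetaKernelDatum

universe u₁ u₂ v

variable {GU : Type u₁} [Group GU] [TopologicalSpace GU] {ΓU : Subgroup GU}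
variable {G : Type u₂} [Group G] [TopologicalSpace G] {Γ : Subgroup G}

/-! ## 1. Over an abstract carrier: a split `Representation` -/

section Split

variable [ContinuousMul GU] [LocallyCompactSpace GU] [ContinuousMul G] [LocallyCompactSpace G]
variable {SX : Type v} {k : Type*} [CommSemiring k] [AddCommMonoid SX] [Module k SX]

/-- **Theta-kernel datum of a split dual pair.**  `Mp := GU × G`, `s := id`, `rat := ΓU × Γ`,
`Θ_Φ(g, h) := Θ(ω(g, h)Φ)`, over the theta-initial topology of `ThetaInitialTopology`; inputs as in the module
docstring. [folklore] -/
def ofDualPairRep (ω : Representation k (GU × G) SX) (dist : SX → ℂ)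
    (hc : ∀ Φ : SX, Continuous fun p : GU × G => dist (ω p Φ))
    (hinv : ∀ γU ∈ ΓU, ∀ γ ∈ Γ, ∀ Φ : SX, dist (ω (γU, γ) Φ) = dist Φ) (SK : Set SX)
    (SK_stable : ∀ (h : G) (Φ : SX), Φ ∈ SK → ω (1, h) Φ ∈ SK) :
    ThetaKernelDatum (GU × G)
      (WeilThetaDatum.ofAction (fun S Φ => ω S Φ) ((ΓU.prod Γ : Subgroup (GU × G)) : Set (GU × G))
        dist).ThetaTop GU ΓU G Γ :=
  ofRepresentation ω ((ΓU.prod Γ : Subgroup (GU × G)) : Set (GU × G)) dist hc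
    (by
      rintro ⟨γU, γ⟩ ⟨hU, hγ⟩ Φ
      exact hinv γU hU γ hγ Φ)
    (MonoidHom.id (GU × G)) continuous_id (fun γU hU γ hγ => ⟨hU, hγ⟩) SK
    (fun h Φ hΦ => SK_stable h Φ hΦ)

section

variable (ω : Representation k (GU × G) SX) (dist : SX → ℂ)
  (hc : ∀ Φ : SX, Continuous fun p : GU × G => dist (ω p Φ))
  (hinv : ∀ γU ∈ ΓU, ∀ γ ∈ Γ, ∀ Φ : SX, dist (ω (γU, γ) Φ) = dist Φ) (SK : Set SX)
  (SK_stable : ∀ (h : G) (Φ : SX), Φ ∈ SK → ω (1, h) Φ ∈ SK)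

/-- The splitting of the split datum is the identity of `GU × G`. [folklore] -/
@[simp] theorem ofDualPairRep_s :
    (ofDualPairRep (ΓU := ΓU) (Γ := Γ) ω dist hc hinv SK SK_stable).s = MonoidHom.id (GU × G) := rfl

/-- The index set of the split datum is `SK`. [folklore] -/
@[simp] theorem ofDualPairRep_SK :
    (ofDualPairRep (ΓU := ΓU) (Γ := Γ) ω dist hc hinv SK SK_stable).SK = SK := rfl

/-- The Weil datum's action is `ω`. [folklore] -/
@[simp] theorem ofDualPairRep_act (S : GU × G) (Φ : SX) :
    (ofDualPairRep (ΓU := ΓU) (Γ := Γ) ω dist hc hinv SK SK_stable).W.act S Φ = ω S Φ := rfl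

/-- The Weil datum's theta function is `Θ_Φ(S) = Θ(ω(S)Φ)`. [folklore] -/
@[simp] theorem ofDualPairRep_theta (Φ : SX) (S : GU × G) :
    (ofDualPairRep (ΓU := ΓU) (Γ := Γ) ω dist hc hinv SK SK_stable).W.theta Φ S = dist (ω S Φ) := rfl

/-- `ω(h) := s(1, h)` acting on `S(X_A)` is `ω(1, h)`. [folklore] -/
theorem ofDualPairRep_act_s_one (h : G) (Φ : SX) :
    (ofDualPairRep (ΓU := ΓU) (Γ := Γ) ω dist hc hinv SK SK_stable).W.act
        ((ofDualPairRep (ΓU := ΓU) (Γ := Γ) ω dist hc hinv SK SK_stable).s (1, h)) Φ = ω (1, h) Φ := rfl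

/-- Weil's kernel for the split datum: `θ_Φ(x, h) = Θ(ω(x⁻¹, h⁻¹)Φ)`. [folklore] -/
theorem ofDualPairRep_thetaFun_mk (Φ : SX) (x : GU) (h : G) :
    (ofDualPairRep (ΓU := ΓU) (Γ := Γ) ω dist hc hinv SK SK_stable).thetaFun Φ (x, h) =
      dist (ω (x⁻¹, h⁻¹) Φ) := rfl

/-- … equivalently `θ_Φ(p) = Θ(ω(p⁻¹)Φ)`. [folklore] -/
theorem ofDualPairRep_thetaFun (Φ : SX) (p : GU × G) :
    (ofDualPairRep (ΓU := ΓU) (Γ := Γ) ω dist hc hinv SK SK_stable).thetaFun Φ p = dist (ω p⁻¹ Φ) := rfl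

end

end Split

/-! ## 2. Over the adelic Schwartz–Bruhat carrier: majorised representations -/

section Adelic

open Literature.NumberTheory.Automorphic NumberField

variable {F : Type} [Field F] [NumberField F] {ι : Type} [Fintype ι]
variable {Mp : Type*} [Group Mp] [TopologicalSpace Mp] [ContinuousMul Mp] [LocallyCompactSpace Mp]

/-- **Theta-kernel datum of a majorised representation on `𝒮(𝔸_F^ι)`**, pulled back along a continuous
splitting `s : GU × G →* Mp` with `s(ΓU × Γ) ⊆ rat`: the Weil datum is `repWeilThetaDatum F ι ρ rat`
(`Θ_Φ(g) = Θ(ρ(g)Φ)`), Théorème 6 is `thetaContinuousInvariant_repWeilThetaDatum hρ hrat`, n° 39 and the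
continuity of `Θ` hold for the theta-initial topology (`ofThetaContinuous`).
[cite: Weil1964, Chap. III n° 41, Thm 6 p. 193] -/
noncomputable def ofThetaMajorants (ρ : Mp →* (Module.End ℂ (piSchwartzBruhat F ι))ˣ) (rat : Set Mp)
    (hρ : HasThetaMajorants fun g Φ => (ρ g : Module.End ℂ (piSchwartzBruhat F ι)) Φ)
    (hrat : ∀ γ ∈ rat, ρ γ ∈ thetaStabilizer F ι) (s : GU × G →* Mp) (s_cont : Continuous s)
    (s_rat : ∀ γU ∈ ΓU, ∀ γ ∈ Γ, s (γU, γ) ∈ rat) (SK : Set (piSchwartzBruhat F ι))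
    (SK_stable : ∀ (h : G) (Φ : piSchwartzBruhat F ι), Φ ∈ SK →
      (ρ (s (1, h)) : Module.End ℂ (piSchwartzBruhat F ι)) Φ ∈ SK) :
    ThetaKernelDatum Mp (repWeilThetaDatum F ι ρ rat).ThetaTop GU ΓU G Γ :=
  ofThetaContinuous (repWeilThetaDatum F ι ρ rat) (repWeilThetaDatum_act_one ρ rat)
    (repWeilThetaDatum_theta_act ρ rat) (thetaContinuousInvariant_repWeilThetaDatum ρ rat hρ hrat) s s_cont
    s_rat SK SK_stable

section

variable (ρ : Mp →* (Module.End ℂ (piSchwartzBruhat F ι))ˣ) (rat : Set Mp)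
  (hρ : HasThetaMajorants fun g Φ => (ρ g : Module.End ℂ (piSchwartzBruhat F ι)) Φ)
  (hrat : ∀ γ ∈ rat, ρ γ ∈ thetaStabilizer F ι) (s : GU × G →* Mp) (s_cont : Continuous s)
  (s_rat : ∀ γU ∈ ΓU, ∀ γ ∈ Γ, s (γU, γ) ∈ rat) (SK : Set (piSchwartzBruhat F ι))
  (SK_stable : ∀ (h : G) (Φ : piSchwartzBruhat F ι), Φ ∈ SK →
    (ρ (s (1, h)) : Module.End ℂ (piSchwartzBruhat F ι)) Φ ∈ SK)

/-- The splitting of `ofThetaMajorants` is `s`. [folklore] -/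
@[simp] theorem ofThetaMajorants_s :
    (ofThetaMajorants (ΓU := ΓU) (Γ := Γ) ρ rat hρ hrat s s_cont s_rat SK SK_stable).s = s := rfl

/-- The index set of `ofThetaMajorants` is `SK`. [folklore] -/
@[simp] theorem ofThetaMajorants_SK :
    (ofThetaMajorants (ΓU := ΓU) (Γ := Γ) ρ rat hρ hrat s s_cont s_rat SK SK_stable).SK = SK := rfl

/-- Weil's kernel of a majorised representation: `θ_Φ(x, h) = Θ(ρ(s(x⁻¹, h⁻¹))Φ)`.
[cite: Weil1964, Chap. III n° 41, p. 193] -/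
theorem ofThetaMajorants_thetaFun_mk (Φ : piSchwartzBruhat F ι) (x : GU) (h : G) :
    (ofThetaMajorants (ΓU := ΓU) (Γ := Γ) ρ rat hρ hrat s s_cont s_rat SK SK_stable).thetaFun Φ (x, h) =
      thetaDistLM F ι ((ρ (s (x⁻¹, h⁻¹)) : Module.End ℂ (piSchwartzBruhat F ι)) Φ) := rfl

/-- … as a series: `θ_Φ(x, h) = Σ_{ξ ∈ F^ι} (ρ(s(x⁻¹, h⁻¹))Φ)(ξ)`. [cite: Weil1964, Chap. III n° 41, p. 193] -/
theorem ofThetaMajorants_thetaFun_mk_eq_tsum (Φ : piSchwartzBruhat F ι) (x : GU) (h : G) :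
    (ofThetaMajorants (ΓU := ΓU) (Γ := Γ) ρ rat hρ hrat s s_cont s_rat SK SK_stable).thetaFun Φ (x, h) =
      ∑' ξ : ι → F, (((ρ (s (x⁻¹, h⁻¹)) : Module.End ℂ (piSchwartzBruhat F ι)) Φ : piSchwartzBruhat F ι) :
        (ι → AdeleRing (𝓞 F) F) → ℂ) (ratPt F ι ξ) := rfl

end

section SplitPair

variable [ContinuousMul GU] [LocallyCompactSpace GU] [ContinuousMul G] [LocallyCompactSpace G]

/-- **The adelic theta-kernel datum of a split dual pair**: `Mp := GU × G`, `s := id`, `rat := ΓU × Γ`, for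
a homomorphism `ρ : GU × G →* (End_ℂ 𝒮(𝔸_F^ι))ˣ` (the linearised Weil representation of the pair) with
theta majorants and `ρ(ΓU × Γ) ⊆ thetaStabilizer`. [cite: Weil1964, Chap. III n° 41, Thm 6 p. 193] -/
noncomputable def adelicOfDualPair (ρ : GU × G →* (Module.End ℂ (piSchwartzBruhat F ι))ˣ)
    (hρ : HasThetaMajorants fun g Φ => (ρ g : Module.End ℂ (piSchwartzBruhat F ι)) Φ)
    (hrat : ∀ γU ∈ ΓU, ∀ γ ∈ Γ, ρ (γU, γ) ∈ thetaStabilizer F ι) (SK : Set (piSchwartzBruhat F ι))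
    (SK_stable : ∀ (h : G) (Φ : piSchwartzBruhat F ι), Φ ∈ SK →
      (ρ (1, h) : Module.End ℂ (piSchwartzBruhat F ι)) Φ ∈ SK) :
    ThetaKernelDatum (GU × G)
      (repWeilThetaDatum F ι ρ ((ΓU.prod Γ : Subgroup (GU × G)) : Set (GU × G))).ThetaTop GU ΓU G Γ :=
  ofThetaMajorants ρ ((ΓU.prod Γ : Subgroup (GU × G)) : Set (GU × G)) hρ
    (by
      rintro ⟨γU, γ⟩ ⟨hU, hγ⟩
      exact hrat γU hU γ hγ)
    (MonoidHom.id (GU × G)) continuous_id (fun γU hU γ hγ => ⟨hU, hγ⟩) SK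
    (fun h Φ hΦ => SK_stable h Φ hΦ)

section

variable (ρ : GU × G →* (Module.End ℂ (piSchwartzBruhat F ι))ˣ)
  (hρ : HasThetaMajorants fun g Φ => (ρ g : Module.End ℂ (piSchwartzBruhat F ι)) Φ)
  (hrat : ∀ γU ∈ ΓU, ∀ γ ∈ Γ, ρ (γU, γ) ∈ thetaStabilizer F ι) (SK : Set (piSchwartzBruhat F ι))
  (SK_stable : ∀ (h : G) (Φ : piSchwartzBruhat F ι), Φ ∈ SK →
    (ρ (1, h) : Module.End ℂ (piSchwartzBruhat F ι)) Φ ∈ SK)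

/-- The splitting of the split adelic datum is the identity. [folklore] -/
@[simp] theorem adelicOfDualPair_s :
    (adelicOfDualPair (ΓU := ΓU) (Γ := Γ) ρ hρ hrat SK SK_stable).s = MonoidHom.id (GU × G) := rfl

/-- The index set of the split adelic datum is `SK`. [folklore] -/
@[simp] theorem adelicOfDualPair_SK :
    (adelicOfDualPair (ΓU := ΓU) (Γ := Γ) ρ hρ hrat SK SK_stable).SK = SK := rfl

/-- The Weil action of the split adelic datum is `ρ`. [folklore] -/
@[simp] theorem adelicOfDualPair_act (S : GU × G) (Φ : piSchwartzBruhat F ι) :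
    (adelicOfDualPair (ΓU := ΓU) (Γ := Γ) ρ hρ hrat SK SK_stable).W.act S Φ =
      (ρ S : Module.End ℂ (piSchwartzBruhat F ι)) Φ := rfl

/-- `ω(h) = s(1, h)` acts by `ρ(1, h)`. [folklore] -/
theorem adelicOfDualPair_act_s_one (h : G) (Φ : piSchwartzBruhat F ι) :
    (adelicOfDualPair (ΓU := ΓU) (Γ := Γ) ρ hρ hrat SK SK_stable).W.act
        ((adelicOfDualPair (ΓU := ΓU) (Γ := Γ) ρ hρ hrat SK SK_stable).s (1, h)) Φ =
      (ρ (1, h) : Module.End ℂ (piSchwartzBruhat F ι)) Φ := rfl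

/-- **Weil's adelic theta kernel of the pair**: `θ_Φ(x, h) = Θ(ρ(x⁻¹, h⁻¹)Φ)`.
[cite: Weil1964, Chap. III n° 41, p. 193] -/
theorem adelicOfDualPair_thetaFun_mk (Φ : piSchwartzBruhat F ι) (x : GU) (h : G) :
    (adelicOfDualPair (ΓU := ΓU) (Γ := Γ) ρ hρ hrat SK SK_stable).thetaFun Φ (x, h) =
      thetaDistLM F ι ((ρ (x⁻¹, h⁻¹) : Module.End ℂ (piSchwartzBruhat F ι)) Φ) := rfl

/-- … as a series: `θ_Φ(x, h) = Σ_{ξ ∈ F^ι} (ρ(x⁻¹, h⁻¹)Φ)(ξ)`. [cite: Weil1964, Chap. III n° 41, p. 193] -/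
theorem adelicOfDualPair_thetaFun_mk_eq_tsum (Φ : piSchwartzBruhat F ι) (x : GU) (h : G) :
    (adelicOfDualPair (ΓU := ΓU) (Γ := Γ) ρ hρ hrat SK SK_stable).thetaFun Φ (x, h) =
      ∑' ξ : ι → F, (((ρ (x⁻¹, h⁻¹) : Module.End ℂ (piSchwartzBruhat F ι)) Φ : piSchwartzBruhat F ι) :
        (ι → AdeleRing (𝓞 F) F) → ℂ) (ratPt F ι ξ) := rfl

/-- The kernel is continuous in `(x, h)` (from `continuous_thetaFun`). [folklore] -/
theorem continuous_adelicOfDualPair_thetaFun [ContinuousInv GU] [ContinuousInv G] (Φ : piSchwartzBruhat F ι) :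
    Continuous ((adelicOfDualPair (ΓU := ΓU) (Γ := Γ) ρ hρ hrat SK SK_stable).thetaFun Φ) :=
  (adelicOfDualPair (ΓU := ΓU) (Γ := Γ) ρ hρ hrat SK SK_stable).continuous_thetaFun Φ

/-- The kernel is right-`ΓU × Γ`-invariant: `θ_Φ(p · (γU, γ)) = θ_Φ(p)` (from `thetaFun_mul_right`).
[folklore] -/
theorem adelicOfDualPair_thetaFun_mul_right (Φ : piSchwartzBruhat F ι) (p : GU × G) {γU : GU}
    (hU : γU ∈ ΓU) {γ : G} (hγ : γ ∈ Γ) :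
    (adelicOfDualPair (ΓU := ΓU) (Γ := Γ) ρ hρ hrat SK SK_stable).thetaFun Φ (p * (γU, γ)) =
      (adelicOfDualPair (ΓU := ΓU) (Γ := Γ) ρ hρ hrat SK SK_stable).thetaFun Φ p :=
  (adelicOfDualPair (ΓU := ΓU) (Γ := Γ) ρ hρ hrat SK SK_stable).thetaFun_mul_right Φ p hU hγ

end

end SplitPair

/-! ### From a Mathlib `Representation` (the shape `opHom ∘ lift` delivers) -/

section OfRep

/-- The stabiliser condition for `ω.toHomUnits` is `Θ(ω(p)Φ) = Θ(Φ)` for all `Φ`. [folklore] -/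
theorem toHomUnits_mem_thetaStabilizer_iff {H : Type*} [Group H]
    (ω : Representation ℂ H (piSchwartzBruhat F ι)) (p : H) : ω.toHomUnits p ∈ thetaStabilizer F ι ↔
      ∀ Φ : piSchwartzBruhat F ι, thetaDistLM F ι (ω p Φ) = thetaDistLM F ι Φ :=
  (mem_thetaStabilizer_iff_coe_mem (ω.toHomUnits p)).trans (mem_thetaStabilizerEnd_iff _)

variable [ContinuousMul GU] [LocallyCompactSpace GU] [ContinuousMul G] [LocallyCompactSpace G]

/-- A representation of a GROUP takes values in the units of `End`: `ω ↦ ω.toHomUnits`; this is the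
`ρ : GU × G →* (End_ℂ 𝒮)ˣ` fed to `adelicOfDualPair` when the linearised Weil representation is delivered as
a Mathlib `Representation ℂ (GU × G) 𝒮(𝔸_F^ι)`. [folklore] -/
noncomputable def adelicOfDualPairRep (ω : Representation ℂ (GU × G) (piSchwartzBruhat F ι))
    (hω : HasThetaMajorants fun g Φ => ω g Φ)
    (hrat : ∀ γU ∈ ΓU, ∀ γ ∈ Γ, ω.toHomUnits (γU, γ) ∈ thetaStabilizer F ι)
    (SK : Set (piSchwartzBruhat F ι)) (SK_stable : ∀ (h : G) (Φ : piSchwartzBruhat F ι), Φ ∈ SK → ω (1, h) Φ ∈ SK) :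
    ThetaKernelDatum (GU × G)
      (repWeilThetaDatum F ι ω.toHomUnits ((ΓU.prod Γ : Subgroup (GU × G)) : Set (GU × G))).ThetaTop
      GU ΓU G Γ :=
  adelicOfDualPair ω.toHomUnits hω hrat SK SK_stable

section

variable (ω : Representation ℂ (GU × G) (piSchwartzBruhat F ι)) (hω : HasThetaMajorants fun g Φ => ω g Φ)
  (hrat : ∀ γU ∈ ΓU, ∀ γ ∈ Γ, ω.toHomUnits (γU, γ) ∈ thetaStabilizer F ι)
  (SK : Set (piSchwartzBruhat F ι)) (SK_stable : ∀ (h : G) (Φ : piSchwartzBruhat F ι), Φ ∈ SK → ω (1, h) Φ ∈ SK)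

/-- The Weil action of `adelicOfDualPairRep` is `ω`. [folklore] -/
@[simp] theorem adelicOfDualPairRep_act (S : GU × G) (Φ : piSchwartzBruhat F ι) :
    (adelicOfDualPairRep (ΓU := ΓU) (Γ := Γ) ω hω hrat SK SK_stable).W.act S Φ = ω S Φ := rfl

/-- The splitting of `adelicOfDualPairRep` is the identity. [folklore] -/
@[simp] theorem adelicOfDualPairRep_s :
    (adelicOfDualPairRep (ΓU := ΓU) (Γ := Γ) ω hω hrat SK SK_stable).s = MonoidHom.id (GU × G) := rfl

/-- The index set of `adelicOfDualPairRep` is `SK`. [folklore] -/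
@[simp] theorem adelicOfDualPairRep_SK :
    (adelicOfDualPairRep (ΓU := ΓU) (Γ := Γ) ω hω hrat SK SK_stable).SK = SK := rfl

/-- **Weil's adelic theta kernel of the pair, from a `Representation`**: `θ_Φ(x, h) = Θ(ω(x⁻¹, h⁻¹)Φ)`.
[cite: Weil1964, Chap. III n° 41, p. 193] -/
theorem adelicOfDualPairRep_thetaFun_mk (Φ : piSchwartzBruhat F ι) (x : GU) (h : G) :
    (adelicOfDualPairRep (ΓU := ΓU) (Γ := Γ) ω hω hrat SK SK_stable).thetaFun Φ (x, h) =
      thetaDistLM F ι (ω (x⁻¹, h⁻¹) Φ) := rfl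

/-- … as a series: `θ_Φ(x, h) = Σ_{ξ ∈ F^ι} (ω(x⁻¹, h⁻¹)Φ)(ξ)`. [cite: Weil1964, Chap. III n° 41, p. 193] -/
theorem adelicOfDualPairRep_thetaFun_mk_eq_tsum (Φ : piSchwartzBruhat F ι) (x : GU) (h : G) :
    (adelicOfDualPairRep (ΓU := ΓU) (Γ := Γ) ω hω hrat SK SK_stable).thetaFun Φ (x, h) =
      ∑' ξ : ι → F, ((ω (x⁻¹, h⁻¹) Φ : piSchwartzBruhat F ι) : (ι → AdeleRing (𝓞 F) F) → ℂ) (ratPt F ι ξ) :=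
  rfl

end

end OfRep

end Adelic

end ThetaKernelDatum

end Literature.NumberTheory.Weil1964
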